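import Summits.AtomisticToContinuum.Crystallization.Theorems.SummedShellPricing.Negative.PricingClause

/-!
# Negative knowledge for crux `SpectralChargeLedger.SummedShellPricing` (stmt-AtomisticToContinuum-17044), II:
# three refuted strengthenings — no uniform price, no linear price, no exact shells

Refuter file (`--supports stmt-AtomisticToContinuum-17044`; cdisprove seat, cycle 1; mirrors §3 of
`Cruxes/SummedShellPricing/Disproof.lean`; notations `Good⟪…⟫`, `PC⟪…⟫` of part I).
Consequences of the tightness `κ(τ) ≤ 324·(−e⋆)·(τ/a₀)²` (part I): the price of the crux MUST
vanish quadratically as `τ → 0`.  All `[folklore]`.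

* `kappa_nonpos_of_pricingClause_zero` — at `τ = 0` no positive price is admissible;
* `not_uniformKappa` — `∃ κ > 0 ∀ τ ∈ (0,1]` (instead of `∀ τ ∃ κ`) is false;
* `not_linearKappa` — `κ(τ) = c·τ` is false (the shape of the refuted sitewise stmt-17253);
* `summedShellPricing_false_without_tauPos` — the crux with `0 < τ` weakened to `0 ≤ τ` is false.
-/

noncomputable section

namespace Summit.AtomisticToContinuum.Crystallization.Theorems.SummedShellPricing.Negative

open scoped BigOperators
open Literature.MathematicalPhysics.StatisticalMechanics
open Summit.AtomisticToContinuum.Crystallization.Theorems.ChargedEnergyGapNegative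
  (E3 eStar card_mul_eStar_le crysEnergyLimit groundStateEnergy_nonpos)
open Summit.AtomisticToContinuum.Crystallization.Theorems.OneMultiplierPricing.Negative.BarlowShellDilation
open Summit.AtomisticToContinuum.Crystallization.Theses.SpectralChargeLedger (SummedShellPricing)

/-- At `τ = 0` (exact shells) no positive price is admissible: `κ ≤ 0`. [folklore] -/
theorem kappa_nonpos_of_pricingClause_zero {δ : ℝ}
    (hδGS : ∀ (N : ℕ) (x : Fin N → E3), IsGroundState lennardJones x →
      ∀ i j : Fin N, i ≠ j → δ ≤ dist (x i) (x j))
    {a₀ h₀ : ℝ} (ha : 47 / 50 ≤ a₀) (hh : |h₀ - a₀ * Real.sqrt (2 / 3)| ≤ a₀ / 100)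
    {κ : ℝ} (hP : PC⟪δ, a₀, h₀, 0, κ⟫) : κ ≤ 0 := by
  by_contra hcon
  push Not at hcon
  have ha0 : 0 < a₀ := by linarith
  -- `τ := min (1/20) (κ a₀² / (648 (−e⋆)))`-type choice, packaged in `exists_tau_lt` below; inline:
  set M : ℝ := 324 * (-eStar) / a₀ ^ 2 with hM
  have hM0 : 0 ≤ M := div_nonneg (mul_nonneg (by norm_num) neg_eStar_pos.le) (by positivity)
  set τ : ℝ := min (1 / 20) (κ / (2 * (M + 1))) with hτ
  have hτ0 : 0 < τ := lt_min (by norm_num) (div_pos hcon (by positivity))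
  have hτ1 : τ ≤ 1 / 20 := min_le_left _ _
  have hτ2 : τ ≤ κ / (2 * (M + 1)) := min_le_right _ _
  have hle := kappa_le_of_pricingClause hδGS ha hh hτ0 hτ1 (pricingClause_mono_tau hτ0.le hP)
  have hid : 324 * (-eStar) * (τ / a₀) ^ 2 = M * τ ^ 2 := by rw [hM]; field_simp
  rw [hid] at hle
  have hτsq : τ ^ 2 ≤ τ := by nlinarith
  have h1 : M * τ ^ 2 ≤ M * τ := mul_le_mul_of_nonneg_left hτsq hM0
  have h2 : M * τ ≤ M * (κ / (2 * (M + 1))) := mul_le_mul_of_nonneg_left hτ2 hM0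
  have h3 : M * (κ / (2 * (M + 1))) < κ := by
    rw [mul_div_assoc', div_lt_iff₀ (by positivity)]
    nlinarith
  linarith

/-- A tolerance small against a given positive price. [folklore] -/
theorem exists_tau_lt {κ a₀ : ℝ} (hκ : 0 < κ) (ha0 : 0 < a₀) :
    ∃ τ : ℝ, 0 < τ ∧ τ ≤ 1 / 20 ∧ 324 * (-eStar) * (τ / a₀) ^ 2 < κ := by
  set M : ℝ := 324 * (-eStar) / a₀ ^ 2 with hM
  have hM0 : 0 ≤ M := div_nonneg (mul_nonneg (by norm_num) neg_eStar_pos.le) (by positivity)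
  set τ : ℝ := min (1 / 20) (κ / (2 * (M + 1))) with hτ
  have hτ0 : 0 < τ := lt_min (by norm_num) (div_pos hκ (by positivity))
  have hτ1 : τ ≤ 1 / 20 := min_le_left _ _
  have hτ2 : τ ≤ κ / (2 * (M + 1)) := min_le_right _ _
  refine ⟨τ, hτ0, hτ1, ?_⟩
  have hid : 324 * (-eStar) * (τ / a₀) ^ 2 = M * τ ^ 2 := by rw [hM]; field_simp
  rw [hid]
  have hτsq : τ ^ 2 ≤ τ := by nlinarith
  have h1 : M * τ ^ 2 ≤ M * τ := mul_le_mul_of_nonneg_left hτsq hM0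
  have h2 : M * τ ≤ M * (κ / (2 * (M + 1))) := mul_le_mul_of_nonneg_left hτ2 hM0
  have h3 : M * (κ / (2 * (M + 1))) < κ := by
    rw [mul_div_assoc', div_lt_iff₀ (by positivity)]
    nlinarith
  linarith

/-! ## §3 Refuted natural strengthenings -/

/-- **STRENGTHENING 1 refuted — no price UNIFORM in the tolerance** (`∃ κ ∀ τ` instead of
`∀ τ ∃ κ`): dilated ground states (part I, `kappa_le_of_pricingClause`). [folklore] -/
theorem not_uniformKappa :
    ¬ (∀ δ : ℝ, 0 < δ → ∃ a₀ h₀ : ℝ, (47 / 50 ≤ a₀ ∧ a₀ ≤ 1 ∧ |h₀ - a₀ * Real.sqrt (2 / 3)| ≤ a₀ / 100) ∧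
      ∃ κ : ℝ, 0 < κ ∧ ∀ τ : ℝ, 0 < τ → τ ≤ 1 → PC⟪δ, a₀, h₀, τ, κ⟫) := by
  intro H
  obtain ⟨δ, hδ, hGS⟩ := LennardJonesMinimalDistance_holds
  obtain ⟨a₀, h₀, ⟨ha, -, hh⟩, κ, hκ, hP⟩ := H δ hδ
  obtain ⟨τ, hτ0, hτ1, hlt⟩ := exists_tau_lt (a₀ := a₀) hκ (by linarith)
  have := kappa_le_of_pricingClause hGS ha hh hτ0 hτ1 (hP τ hτ0 (by linarith))
  linarith

/-- **STRENGTHENING 2 refuted — no price LINEAR in the tolerance**, `κ(τ) = c·τ` (the shape of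
the refuted sitewise predecessor stmt-17253, in K1's summed clothes): `c τ ≤ 324 (−e⋆) τ²/a₀²`
forces `c ≤ O(τ) → 0`. [folklore] -/
theorem not_linearKappa :
    ¬ (∀ δ : ℝ, 0 < δ → ∃ a₀ h₀ : ℝ, (47 / 50 ≤ a₀ ∧ a₀ ≤ 1 ∧ |h₀ - a₀ * Real.sqrt (2 / 3)| ≤ a₀ / 100) ∧
      ∃ c : ℝ, 0 < c ∧ ∀ τ : ℝ, 0 < τ → τ ≤ 1 → PC⟪δ, a₀, h₀, τ, c * τ⟫) := by
  intro H
  obtain ⟨δ, hδ, hGS⟩ := LennardJonesMinimalDistance_holds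
  obtain ⟨a₀, h₀, ⟨ha, -, hh⟩, c, hc, hP⟩ := H δ hδ
  have ha0 : 0 < a₀ := by linarith
  set M : ℝ := 324 * (-eStar) / a₀ ^ 2 with hM
  have hM0 : 0 ≤ M := div_nonneg (mul_nonneg (by norm_num) neg_eStar_pos.le) (by positivity)
  set τ : ℝ := min (1 / 20) (c / (2 * (M + 1))) with hτ
  have hτ0 : 0 < τ := lt_min (by norm_num) (div_pos hc (by positivity))
  have hτ1 : τ ≤ 1 / 20 := min_le_left _ _
  have hτ2 : τ ≤ c / (2 * (M + 1)) := min_le_right _ _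
  have hle := kappa_le_of_pricingClause hGS ha hh hτ0 hτ1 (hP τ hτ0 (by linarith))
  have hid : 324 * (-eStar) * (τ / a₀) ^ 2 = M * τ ^ 2 := by rw [hM]; field_simp
  rw [hid] at hle
  -- `c τ ≤ M τ²` gives `c ≤ M τ ≤ M c/(2(M+1)) < c`
  have h1 : c ≤ M * τ := by
    have : c * τ ≤ (M * τ) * τ := by nlinarith
    exact le_of_mul_le_mul_right this hτ0
  have h2 : M * τ ≤ M * (c / (2 * (M + 1))) := mul_le_mul_of_nonneg_left hτ2 hM0
  have h3 : M * (c / (2 * (M + 1))) < c := by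
    rw [mul_div_assoc', div_lt_iff₀ (by positivity)]
    nlinarith
  linarith

/-- **`0 < τ` is load-bearing (STRENGTHENING 3 refuted)**: the crux with `0 < τ` weakened to
`0 ≤ τ` (exact shells priced) is FALSE — finite ground states are not certifiably exactly
Barlow-shelled, but they certifiably fail to be so after an infinitesimal dilation
(`kappa_nonpos_of_pricingClause_zero`). [folklore] -/
theorem summedShellPricing_false_without_tauPos :
    ¬ (∀ δ : ℝ, 0 < δ → ∃ a₀ h₀ : ℝ, 47 / 50 ≤ a₀ ∧ a₀ ≤ 1 ∧ |h₀ - a₀ * Real.sqrt (2 / 3)| ≤ a₀ / 100 ∧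
      ∀ τ : ℝ, 0 ≤ τ → τ ≤ 1 → ∃ κ : ℝ, 0 < κ ∧ PC⟪δ, a₀, h₀, τ, κ⟫) := by
  intro H
  obtain ⟨δ, hδ, hGS⟩ := LennardJonesMinimalDistance_holds
  obtain ⟨a₀, h₀, ha, -, hh, hP⟩ := H δ hδ
  obtain ⟨κ, hκ, hP0⟩ := hP 0 le_rfl zero_le_one
  have := kappa_nonpos_of_pricingClause_zero hGS ha hh hP0
  linarith

end Summit.AtomisticToContinuum.Crystallization.Theorems.SummedShellPricing.Negative

end
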